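import Summits.CriticalPhenomena.PercolationContinuityZ3.Theorems.PercNearOneGluingNoHeavyLowerTailPreFloorSplitLevelOne
import Summits.CriticalPhenomena.PercolationContinuityZ3.Theorems.PercNearOneGluingNoHeavyLowerTailAttachedChampionLevelOne
import HarnessLib

/-!
# `NoHeavyLowerTail` (stmt-CriticalPhenomena-4575) — the pre-FKG floor split at level one, in the socket's vocabulary

Lemma factory #5 (`prim-lf-5`, gen 12; memo `run/shared/lean/prim/prim-lf-5/PRE-FSCIL.md` §6).
`--supports stmt-CriticalPhenomena-4575`.  No definitions, no named facts, no sorries.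

`PreFloorSplitLevelOne.preFloorSplit_level_one` (every observer, level `j = 1`, `S`-champion, non-null lonely world) restated
with the `Finset.filter`/`card` events of the socket `noHeavyLowerTail_of_preFloorSplitCIL` (`…PreFloorSplitCIL.lean`): this is
literally that socket's hypothesis `hPre` at `j = 1` under the side condition `μ(A pairwise separated) ≠ 0`
(`preFloorSplit_level_one_card`), together with the set identity `{|π(q)| = 1} = {q ↮ A ∖ q}` (`q ∈ A`; the `≤ 1` and
`{1 ≤ N ∧ N ≤ 1}` forms are `AttachedChampionLevelOne.setOf_card_le_one_eq` / `setOf_card_eq_one_eq`).  So the first OPEN instance of `hPre` is `j = 2`.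
-/

noncomputable section

namespace Summit.CriticalPhenomena.PercolationContinuityZ3.Theorems

open MeasureTheory Set Filter Literature.Probability.LatticeModels Literature.Probability.Percolation
open scoped Classical BigOperators Topology

namespace PreFloorSplitLevelOne

variable {n : ℕ}

/-- For `q ∈ A`: `{|π(q)| = 1} = {q ↮ A ∖ q}` (`q` always lies in its own pocket). [folklore] -/
theorem setOf_card_eq_one_eq_sep (A : Finset (Fin n)) {q : Fin n} (hq : q ∈ A) :
    {ω : Set (Sym2 (Fin n)) | (A.filter fun x => ω ∈ openConn q x).card = 1} =
      {ω | ∀ t ∈ A.erase q, ω ∉ openConn q t} := by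
  rw [← AttachedChampionLevelOne.setOf_card_le_one_eq A hq]
  ext ω
  simp only [Set.mem_setOf_eq]
  have h1 : 1 ≤ (A.filter fun x => ω ∈ openConn q x).card :=
    Finset.card_pos.2 ⟨q, Finset.mem_filter.2 ⟨hq, (SimpleGraph.Reachable.refl q : (openGraph ω).Reachable q q)⟩⟩
  omega

/-- **The pre-FKG floor split at level one, in the binder vocabulary of `noHeavyLowerTail_of_preFloorSplitCIL`** (its
hypothesis `hPre` at `j = 1`, for a non-null lonely world): with `N_a = |{x ∈ A : a ↔ x}|`, `X = {o ↔ A}`, `u = μ(X)`,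
`φ_a = μ(o ↔ a, N_a = 1)/μ(N_a = 1)` and an `S`-champion `c ∈ A` (`μ(X, N_a ≤ 1) ≤ μ(X, N_c ≤ 1)` for `a ∈ A`), if
`μ(A pairwise separated) ≠ 0` then `u·μ(1 ≤ N ≤ 1) ≤ Σ_a φ_a μ(X, N_a ≤ 1) + (u − Σ_a φ_a)·μ(X, N_c ≤ 1)`.
[this work; cite: KozmaNitzan2024, Lemma 2 (p. 6), Question 5 (p. 32); VandenbergHaggstromKahn2005, Thm. 1.3] -/
theorem preFloorSplit_level_one_card (w : Sym2 (Fin n) → unitInterval) (A : Finset (Fin n)) (o c : Fin n)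
    (hc : c ∈ A)
    (hSep : (prodBernoulli w).real
      {ω : Set (Sym2 (Fin n)) | ∀ x ∈ A, ∀ y ∈ A, x ≠ y → ω ∉ openConn x y} ≠ 0)
    (hcmax : ∀ a ∈ A,
      (prodBernoulli w).real ((⋃ b ∈ A, (openConn o b : Set (BondConfig (Fin n)))) ∩
          {ω | (A.filter fun x => ω ∈ openConn a x).card ≤ 1}) ≤
        (prodBernoulli w).real ((⋃ b ∈ A, (openConn o b : Set (BondConfig (Fin n)))) ∩
          {ω | (A.filter fun x => ω ∈ openConn c x).card ≤ 1})) :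
    (prodBernoulli w).real (⋃ a ∈ A, (openConn o a : Set (BondConfig (Fin n)))) *
        (prodBernoulli w).real {ω : BondConfig (Fin n) |
          1 ≤ (A.filter fun x => ω ∈ openConn o x).card ∧ (A.filter fun x => ω ∈ openConn o x).card ≤ 1} ≤
      (∑ a ∈ A,
          (prodBernoulli w).real ((openConn o a : Set (BondConfig (Fin n))) ∩
              {ω | (A.filter fun x => ω ∈ openConn a x).card = 1}) /
            (prodBernoulli w).real {ω : BondConfig (Fin n) | (A.filter fun x => ω ∈ openConn a x).card = 1} *
          (prodBernoulli w).real ((⋃ b ∈ A, (openConn o b : Set (BondConfig (Fin n)))) ∩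
            {ω | (A.filter fun x => ω ∈ openConn a x).card ≤ 1})) +
        ((prodBernoulli w).real (⋃ a ∈ A, (openConn o a : Set (BondConfig (Fin n)))) -
            ∑ a ∈ A,
              (prodBernoulli w).real ((openConn o a : Set (BondConfig (Fin n))) ∩
                  {ω | (A.filter fun x => ω ∈ openConn a x).card = 1}) /
                (prodBernoulli w).real {ω : BondConfig (Fin n) | (A.filter fun x => ω ∈ openConn a x).card = 1}) *
          (prodBernoulli w).real ((⋃ b ∈ A, (openConn o b : Set (BondConfig (Fin n)))) ∩
            {ω | (A.filter fun x => ω ∈ openConn c x).card ≤ 1}) := by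
  -- translate the `card` events into the separation events of `preFloorSplit_level_one`
  have hle : ∀ a ∈ A, {ω : BondConfig (Fin n) | (A.filter fun x => ω ∈ openConn a x).card ≤ 1} =
      {ω | ∀ t ∈ A.erase a, ω ∉ openConn a t} :=
    fun a ha => AttachedChampionLevelOne.setOf_card_le_one_eq A ha
  have heq : ∀ a ∈ A, {ω : BondConfig (Fin n) | (A.filter fun x => ω ∈ openConn a x).card = 1} =
      {ω | ∀ t ∈ A.erase a, ω ∉ openConn a t} :=
    fun a ha => setOf_card_eq_one_eq_sep A ha
  have hsumφ : ∑ a ∈ A, (prodBernoulli w).real ((openConn o a : Set (BondConfig (Fin n))) ∩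
          {ω | (A.filter fun x => ω ∈ openConn a x).card = 1}) /
          (prodBernoulli w).real {ω : BondConfig (Fin n) | (A.filter fun x => ω ∈ openConn a x).card = 1} =
      ∑ a ∈ A, (prodBernoulli w).real (openConn o a ∩ {ω | ∀ t ∈ A.erase a, ω ∉ openConn a t}) /
          (prodBernoulli w).real {ω | ∀ t ∈ A.erase a, ω ∉ openConn a t} :=
    Finset.sum_congr rfl fun a ha => by rw [heq a ha]
  have hsumS : ∑ a ∈ A, (prodBernoulli w).real ((openConn o a : Set (BondConfig (Fin n))) ∩
          {ω | (A.filter fun x => ω ∈ openConn a x).card = 1}) /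
          (prodBernoulli w).real {ω : BondConfig (Fin n) | (A.filter fun x => ω ∈ openConn a x).card = 1} *
        (prodBernoulli w).real ((⋃ b ∈ A, (openConn o b : Set (BondConfig (Fin n)))) ∩
          {ω | (A.filter fun x => ω ∈ openConn a x).card ≤ 1}) =
      ∑ a ∈ A, (prodBernoulli w).real (openConn o a ∩ {ω | ∀ t ∈ A.erase a, ω ∉ openConn a t}) /
          (prodBernoulli w).real {ω | ∀ t ∈ A.erase a, ω ∉ openConn a t} *
        (prodBernoulli w).real ((⋃ b ∈ A, openConn o b) ∩ {ω | ∀ t ∈ A.erase a, ω ∉ openConn a t}) :=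
    Finset.sum_congr rfl fun a ha => by rw [heq a ha, hle a ha]
  have hcmax' : ∀ a ∈ A,
      (prodBernoulli w).real ((⋃ b ∈ A, openConn o b) ∩ {ω | ∀ t ∈ A.erase a, ω ∉ openConn a t}) ≤
        (prodBernoulli w).real ((⋃ b ∈ A, openConn o b) ∩ {ω | ∀ t ∈ A.erase c, ω ∉ openConn c t}) := by
    intro a ha
    have := hcmax a ha
    rw [hle a ha, hle c hc] at this
    exact this
  have key := preFloorSplit_level_one w A o c hSep hcmax'
  rw [← AttachedChampionLevelOne.setOf_card_eq_one_eq, hsumS, hsumφ, hle c hc]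
  exact key

end PreFloorSplitLevelOne

end Summit.CriticalPhenomena.PercolationContinuityZ3.Theorems

end
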